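import Mathlib.Analysis.SpecialFunctions.Log.Deriv
import Mathlib.Analysis.Complex.ExponentialBounds
import Literature.Computability.AlgebraicComplexity.BigCwLaserBound
import HarnessLib

/-!
# `ω < 2.3872` (Coppersmith–Winograd 1990, §7: "`ω ≤ 3τ < 2.38719`") — proved

Topic `Literature/Computability/AlgebraicComplexity`.  The level-1 laser-method bound for `CW_6`
(`bigCw_laserBound`, `BigCwLaserBound.lean`; BCS 1997 §15.8, Cor. 15.45 `ω < 2.39` is
`BCS1997_cor1545`, `BigCwOmegaBound.lean`) evaluated at the near-optimal rational point `β = 1/21`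
(`u = 20`, `v = 1`: `P₁ = (22/63, 40/63, 1/63)`), where it equals `2.3871909…`; Coppersmith and
Winograd print the optimum "For `q = 6`, `β ≈ 0.048`, we find `ω ≤ 3τ < 2.38719`" (J. Symbolic
Comput. 9 (1990), §7, last display).  We prove the rounding `ω < 2.3872` (weaker than print):

* `CoppersmithWinograd1990_sec7_omega_lt : omega ℂ < 2.3872`.

Numerical inputs: `Real.log_two_gt_d9` / `Real.log_two_lt_d9` and the Taylor bound
`Real.abs_log_sub_add_sum_range_le`, giving `log 3 ∈ (1.0986121, 1.0986124)`, `log 5 < 1.6094385`,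
`log 7 > 1.94591`, `log 11 < 2.3978959`.  No definitions, no named facts.

## References

* D. Coppersmith, S. Winograd, *Matrix multiplication via arithmetic progressions*, J. Symbolic
  Comput. 9 (1990) 251–280, §7 (last display: `ω ≤ 3τ < 2.38719`). [CoppersmithWinograd1990]
* P. Bürgisser, M. Clausen, M. A. Shokrollahi, *Algebraic Complexity Theory* (1997), §15.8
  (display before Cor. 15.45: `ω ≤ 3 (log(q+2) − H)/((1−β) log q)`, "minimum for `q = 6` and
  `β ≈ 0.048`"). [BurgisserClausenShokrollahi1997]
-/

noncomputable section

open scoped BigOperators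
open Finset Real

namespace Literature.Computability.AlgebraicComplexity

/-! ## Sharper logarithms -/

section Logs

/-- `log 3 > 1.0986121` (fourteen terms of the series for `log(1 − 1/3)`). [folklore] -/
theorem log_three_gt_d7 : (1.0986121 : ℝ) < Real.log 3 := by
  have h := Real.abs_log_sub_add_sum_range_le (x := (1 / 3 : ℝ)) (by rw [abs_of_pos (by norm_num)]; norm_num) 14
  rw [abs_of_pos (by norm_num : (0 : ℝ) < 1 / 3)] at h
  have hs : ∑ i ∈ range 14, (1 / 3 : ℝ) ^ (i + 1) / (i + 1) = 11092950499 / 27358582680 := by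
    simp only [sum_range_succ, sum_range_zero]
    norm_num
  rw [hs, show (1 : ℝ) - 1 / 3 = 2 / 3 by norm_num, Real.log_div (by norm_num) (by norm_num)] at h
  have h2 := Real.log_two_gt_d9
  have h' := (abs_le.1 h).2
  norm_num at h'
  linarith

/-- `log 3 < 1.0986124`. [folklore] -/
theorem log_three_lt_d7 : Real.log 3 < 1.0986124 := by
  have h := Real.abs_log_sub_add_sum_range_le (x := (1 / 3 : ℝ)) (by rw [abs_of_pos (by norm_num)]; norm_num) 14
  rw [abs_of_pos (by norm_num : (0 : ℝ) < 1 / 3)] at h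
  have hs : ∑ i ∈ range 14, (1 / 3 : ℝ) ^ (i + 1) / (i + 1) = 11092950499 / 27358582680 := by
    simp only [sum_range_succ, sum_range_zero]
    norm_num
  rw [hs, show (1 : ℝ) - 1 / 3 = 2 / 3 by norm_num, Real.log_div (by norm_num) (by norm_num)] at h
  have h2 := Real.log_two_lt_d9
  have h' := (abs_le.1 h).1
  norm_num at h'
  linarith

/-- `log 5 < 1.6094385` (eight terms of the series for `log(1 − 1/5)`). [folklore] -/
theorem log_five_lt_d7 : Real.log 5 < 1.6094385 := by
  have h := Real.abs_log_sub_add_sum_range_le (x := (1 / 5 : ℝ)) (by rw [abs_of_pos (by norm_num)]; norm_num) 8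
  rw [abs_of_pos (by norm_num : (0 : ℝ) < 1 / 5)] at h
  have hs : ∑ i ∈ range 8, (1 / 5 : ℝ) ^ (i + 1) / (i + 1) = 14643791 / 65625000 := by
    simp only [sum_range_succ, sum_range_zero]
    norm_num
  have h45 : Real.log ((1 : ℝ) - 1 / 5) = 2 * Real.log 2 - Real.log 5 := by
    rw [show (1 : ℝ) - 1 / 5 = 2 ^ 2 / 5 by norm_num, Real.log_div (by norm_num) (by norm_num),
      Real.log_pow]; push_cast; ring
  rw [hs, h45] at h
  have h2 := Real.log_two_lt_d9
  have h' := (abs_le.1 h).1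
  norm_num at h'
  linarith

/-- `log 7 > 1.94591` (`log 7 = 3 log 2 + log(1 − 1/8)`, seven terms). [folklore] -/
theorem log_seven_gt : (1.94591 : ℝ) < Real.log 7 := by
  have h := Real.abs_log_sub_add_sum_range_le (x := (1 / 8 : ℝ)) (by rw [abs_of_pos (by norm_num)]; norm_num) 7
  rw [abs_of_pos (by norm_num : (0 : ℝ) < 1 / 8)] at h
  have hs : ∑ i ∈ range 7, (1 / 8 : ℝ) ^ (i + 1) / (i + 1) = 29403739 / 220200960 := by
    simp only [sum_range_succ, sum_range_zero]
    norm_num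
  have h78 : Real.log ((1 : ℝ) - 1 / 8) = Real.log 7 - 3 * Real.log 2 := by
    rw [show (1 : ℝ) - 1 / 8 = 7 / 2 ^ 3 by norm_num, Real.log_div (by norm_num) (by norm_num),
      Real.log_pow]; push_cast; ring
  rw [hs, h78] at h
  have h2 := Real.log_two_gt_d9
  have h' := (abs_le.1 h).1
  norm_num at h'
  linarith

/-- `log 11 < 2.3978959` (`log 11 = 2 log 2 + log 3 + log(1 − 1/12)`, five terms). [folklore] -/
theorem log_eleven_lt : Real.log 11 < 2.3978959 := by
  have h := Real.abs_log_sub_add_sum_range_le (x := (1 / 12 : ℝ)) (by rw [abs_of_pos (by norm_num)]; norm_num) 5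
  rw [abs_of_pos (by norm_num : (0 : ℝ) < 1 / 12)] at h
  have hs : ∑ i ∈ range 5, (1 / 12 : ℝ) ^ (i + 1) / (i + 1) = 3383 / 38880 := by
    simp only [sum_range_succ, sum_range_zero]
    norm_num
  have h1112 : Real.log ((1 : ℝ) - 1 / 12) = Real.log 11 - (2 * Real.log 2 + Real.log 3) := by
    rw [show (1 : ℝ) - 1 / 12 = 11 / (2 ^ 2 * 3) by norm_num, Real.log_div (by norm_num) (by norm_num),
      Real.log_mul (by norm_num) (by norm_num), Real.log_pow]; push_cast; ring
  rw [hs, h1112] at h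
  have h2 := Real.log_two_lt_d9
  have h3 := log_three_lt_d7
  have h' := (abs_le.1 h).2
  norm_num at h'
  linarith

end Logs

/-! ## The bound -/

section Omega

/-- **Coppersmith–Winograd 1990, §7: `ω < 2.3872`** (printed: "`ω ≤ 3τ < 2.38719`" at the optimum
`q = 6`, `β ≈ 0.048`), over `ℂ` — the level-1 laser-method bound for `CW_6` (`bigCw_laserBound`) at
`β = 1/21`: `ω ≤ 3 · (21/20) · (log 8 − H(22/63, 40/63, 1/63)) / log 6 = 2.38719… < 2.3872`.
[cite: CoppersmithWinograd1990, §7 (last display)] -/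
theorem CoppersmithWinograd1990_sec7_omega_lt : omega ℂ < 2.3872 := by
  have h := omega_le_bigCw_laserBound 6 (by norm_num) 20 1 (by norm_num)
  have hL2 := Real.log_two_gt_d9
  have hL2' := Real.log_two_lt_d9
  have hL3 := log_three_gt_d7
  have hL3' := log_three_lt_d7
  have hL5 := log_five_lt_d7
  have hL7 := log_seven_gt
  have hL11 := log_eleven_lt
  have e8 : Real.log ((6 : ℕ) + 2 : ℝ) = 3 * Real.log 2 := by
    rw [show ((6 : ℕ) + 2 : ℝ) = 2 ^ 3 by norm_num, Real.log_pow]; push_cast; ring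
  have e6 : Real.log ((6 : ℕ) : ℝ) = Real.log 2 + Real.log 3 := by
    rw [show ((6 : ℕ) : ℝ) = 2 * 3 by norm_num, Real.log_mul (by norm_num) (by norm_num)]
  have hlog6 : 0 < Real.log ((6 : ℕ) : ℝ) := by rw [e6]; linarith
  have e0 : negMulLog ((((20 : ℕ) : ℝ) + 2 * ((1 : ℕ) : ℝ)) / (3 * (((20 : ℕ) : ℝ) + ((1 : ℕ) : ℝ)))) =
      -(22 / 63) * (Real.log 2 + Real.log 11 - (2 * Real.log 3 + Real.log 7)) := by
    rw [show ((((20 : ℕ) : ℝ) + 2 * ((1 : ℕ) : ℝ)) / (3 * (((20 : ℕ) : ℝ) + ((1 : ℕ) : ℝ)))) =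
      (2 * 11) / (3 ^ 2 * 7) by norm_num, negMulLog, Real.log_div (by norm_num) (by norm_num),
      Real.log_mul (by norm_num) (by norm_num), Real.log_mul (by norm_num) (by norm_num), Real.log_pow]
    push_cast; ring
  have e1 : negMulLog ((2 * ((20 : ℕ) : ℝ)) / (3 * (((20 : ℕ) : ℝ) + ((1 : ℕ) : ℝ)))) =
      -(40 / 63) * (3 * Real.log 2 + Real.log 5 - (2 * Real.log 3 + Real.log 7)) := by
    rw [show ((2 * ((20 : ℕ) : ℝ)) / (3 * (((20 : ℕ) : ℝ) + ((1 : ℕ) : ℝ)))) = (2 ^ 3 * 5) / (3 ^ 2 * 7)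
      by norm_num, negMulLog, Real.log_div (by norm_num) (by norm_num),
      Real.log_mul (by norm_num) (by norm_num), Real.log_mul (by norm_num) (by norm_num), Real.log_pow,
      Real.log_pow]
    push_cast; ring
  have e2 : negMulLog ((((1 : ℕ) : ℝ)) / (3 * (((20 : ℕ) : ℝ) + ((1 : ℕ) : ℝ)))) =
      -(1 / 63) * (-(2 * Real.log 3 + Real.log 7)) := by
    rw [show ((((1 : ℕ) : ℝ)) / (3 * (((20 : ℕ) : ℝ) + ((1 : ℕ) : ℝ)))) = 1 / (3 ^ 2 * 7) by norm_num,
      negMulLog, Real.log_div (by norm_num) (by norm_num), Real.log_one,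
      Real.log_mul (by norm_num) (by norm_num), Real.log_pow]
    push_cast; ring
  rw [e8, e6, e0, e1, e2] at h
  have ecoef : (3 : ℝ) * ((((20 : ℕ) : ℝ) + ((1 : ℕ) : ℝ)) / ((20 : ℕ) : ℝ)) = 63 / 20 := by norm_num
  rw [ecoef] at h
  rw [e6] at hlog6
  rw [le_div_iff₀ hlog6] at h
  nlinarith [h, hL2, hL2', hL3, hL3', hL5, hL7, hL11, hlog6]

end Omega

end Literature.Computability.AlgebraicComplexity

end
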